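import Summits.BirchSwinnertonDyer.BirchSwinnertonDyer.Theses.TwoAdicConverse
import Summits.BirchSwinnertonDyer.BirchSwinnertonDyer.Theorems.TwoAdicConverseKatoZetaDefs
import HarnessLib

/-!
# Route `TwoAdicConverse`: the rank-`0` cruxes 19219 / 19218 BY NAME from the carrier's object
# `TwoAdicKatoZeta.KatoMainConjectureAtTAtTwoOnLeaf` (Kato Conj. 12.10 at `(T)` for the pinned `p = 2` zeta lift)

Seat bsd-2adic-conv-2 GEN 10. THEOREMS ONLY (one `unfold; exact` each over the Theses-free carrier
`Theorems/TwoAdicConverseKatoZetaDefs.lean`, §3 `onLeaf_rankZero_twoConverse_of_katoMainConjectureAtT`): the planner's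
RC-31 glue shape «`<ZetaPub> → <KatoZetaAtTAtTwo> → MultiplicativeRankZeroTwoConverse`» with `<ZetaPub>` = the four
NAMED facts `nonempty_iwasawaH1Data`, `nonempty_iwasawaH2Data`, `thm12_4`, `finite_descentCokernel_of_finite_selmer`
and the two displayed READINGS (R-𝐳) «a `ZetaBody` witness for a newform of `W` exists at `2`», (NZ ∧ VAN-𝐲) «its lift
is non-zero, and `Sel_{2^∞}` finite ∧ `L(E,1) = 0 ⟹ proj₀ 𝐲` torsion» (Kato Thm. 12.5 (2) / (1); Literature-fact
material), and `<KatoZetaAtTAtTwo>` = `KatoMainConjectureAtTAtTwoOnLeaf` (or the reduction-free `…NonCM`, via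
`katoMainConjectureAtTAtTwoOnLeaf_of_nonCM`). Nothing asserted; conditional bridges, credit nothing; BSD is not
advanced. PARTITION: none — RANK axis (S3 items 19219/19218); companion X5@2 (B1·O1).

References: [BurungaleTian2026] Thm. 3.1, Remark 3.2; [Kato2004Asterisque] Thm. 12.4–12.5, Conj. 12.10, (14.9.3), §14.14.
-/

set_option autoImplicit false
set_option linter.dupNamespace false

noncomputable section

open scoped Classical NumberField TensorProduct
open WeierstrassCurve Field IsDedekindDomain Literature.NumberTheory.EllipticCurves
  Literature.NumberTheory.EllipticCurves.ModularForms
  Literature.NumberTheory.EllipticCurves.Kato2004 Literature.NumberTheory.EllipticCurves.IwasawaAlgebra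
  Literature.NumberTheory.EllipticCurves.Kato2004.EulerSystemValues
  Literature.NumberTheory.GaloisRepresentations
  Literature.NumberTheory.EllipticCurves.Rank1Residual
  Summit.BirchSwinnertonDyer.BirchSwinnertonDyer.Theorems.TwoAdicKatoZeta

namespace Summit.BirchSwinnertonDyer.BirchSwinnertonDyer.Theorems.TwoAdicKatoZetaGlue

/-- **Item 19219 `MultiplicativeRankZeroTwoConverse` BY NAME from Kato's Conj. 12.10 at `(T)` for the pinned `p = 2`
zeta lift on the leaf's scope** (`KatoMainConjectureAtTAtTwoOnLeaf`), four named facts (`nonempty_iwasawaH1Data`,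
`nonempty_iwasawaH2Data`, `thm12_4`, `finite_descentCokernel_of_finite_selmer`) and the two displayed readings (R-𝐳),
(NZ ∧ VAN-𝐲) of the carrier. No `p`-adic `L`-function, no A235/A236, no Spieß/Greenberg–Stevens, no period, no K11, no
split/non-split distinction. Nothing asserted; closes nothing by itself.
[cite: BurungaleTian2026, Thm. 3.1 and Remark 3.2] [cite: Kato2004Asterisque, Conj. 12.10 (p. 224), Thm. 12.5 (1)(2) (p. 222), §14.14 (p. 243)] -/
theorem multiplicativeRankZeroTwoConverse_of_katoMainConjectureAtT
    (h1 : nonempty_iwasawaH1Data) (h2 : nonempty_iwasawaH2Data) (h12 : thm12_4)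
    (h31 : finite_descentCokernel_of_finite_selmer)
    (hbody : ∀ (W : WeierstrassCurve ℚ) [W.IsElliptic] [W.IsGloballyMinimal], ¬ W.HasCM →
      letI : ContinuousSMul ℤ_[2] (W.tateModule 2) := TateModule.continuousSMul_padicInt
      haveI : Module.Free ℤ_[2] (W.tateModule 2) := W.module_free_tateModule_holds 2
      haveI : Module.Finite ℤ_[2] (W.tateModule 2) := W.module_finite_tateModule_holds 2
      ∃ (N : ℕ) (_ : NeZero N) (f : CuspForm (CongruenceSubgroup.Gamma0 N) 2) (_ : IsNewformOf W f)
        (ι : (m : ℕ) → (CyclotomicField m ℚ →+* ℂ)) (κ' : ℝ)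
        (Λ' : ∀ (k : ℕ) (r : Finset (HeightOneSpectrum (𝓞 ℚ))),
          H1 (tateRep W 2) (cycSubgroup 2 k r) →ₗ[ℤ_[2]] ℚ_[2] ⊗[ℚ] CyclotomicField (cycLevel 2 k r) ℚ)
        (c d a : ℤ) (A : ℕ)
        (z : ∀ (k : ℕ) (r : (cyclotomicLevelsRat 2 (badPlaces c d A N)).Ideals),
          H1 (tateRep W 2) ((cyclotomicLevelsRat 2 (badPlaces c d A N)).level k r.1))
        (x : ∀ (k : ℕ) (r : (cyclotomicLevelsRat 2 (badPlaces c d A N)).Ideals),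
          CyclotomicField (cycLevel 2 k r.1) ℚ),
        ZetaBody W 2 f ι κ' Λ' c d a A z x)
    (hread : ∀ (W : WeierstrassCurve ℚ) [W.IsElliptic] [W.IsGloballyMinimal], ¬ W.HasCM →
      letI : ContinuousSMul ℤ_[2] (W.tateModule 2) := TateModule.continuousSMul_padicInt
      haveI : Module.Free ℤ_[2] (W.tateModule 2) := W.module_free_tateModule_holds 2
      haveI : Module.Finite ℤ_[2] (W.tateModule 2) := W.module_finite_tateModule_holds 2
      ∀ (κ : ZpExtension ℚ 2) (γ : absoluteGaloisGroup ℚ) (hκ : κ.IsCyclotomic), κ.IsTopGenerator γ →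
      ∀ (I : IwasawaH1Data W 2 κ γ) ⦃N : ℕ⦄ [NeZero N] (f : CuspForm (CongruenceSubgroup.Gamma0 N) 2),
        IsNewformOf W f →
      ∀ (ι : (m : ℕ) → (CyclotomicField m ℚ →+* ℂ)) (κ' : ℝ)
        (Λ' : ∀ (k : ℕ) (r : Finset (HeightOneSpectrum (𝓞 ℚ))),
          H1 (tateRep W 2) (cycSubgroup 2 k r) →ₗ[ℤ_[2]] ℚ_[2] ⊗[ℚ] CyclotomicField (cycLevel 2 k r) ℚ)
        (c d a : ℤ) (A : ℕ)
        (z : ∀ (k : ℕ) (r : (cyclotomicLevelsRat 2 (badPlaces c d A N)).Ideals),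
          H1 (tateRep W 2) ((cyclotomicLevelsRat 2 (badPlaces c d A N)).level k r.1))
        (x : ∀ (k : ℕ) (r : (cyclotomicLevelsRat 2 (badPlaces c d A N)).Ideals),
          CyclotomicField (cycLevel 2 k r.1) ℚ),
        ZetaBody W 2 f ι κ' Λ' c d a A z x →
      ∀ y : I.H, (∀ n : ℕ, I.proj n y = levelToLayerTwo W hκ (badPlaces c d A N) n
          (z (n + 2) (cyclotomicLevelsRat 2 (badPlaces c d A N)).idealOne)) →
        y ≠ 0 ∧ (Finite (W.selmerGroupPInfty 2) → W.entireLFunction 1 = 0 → ∃ n : ℕ, 2 ^ n • I.proj 0 y = 0))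
    (hMC : KatoMainConjectureAtTAtTwoOnLeaf) :
    Summit.BirchSwinnertonDyer.BirchSwinnertonDyer.Theses.TwoAdicConverse.MultiplicativeRankZeroTwoConverse := by
  unfold Summit.BirchSwinnertonDyer.BirchSwinnertonDyer.Theses.TwoAdicConverse.MultiplicativeRankZeroTwoConverse
  intro W _ _ hcm hmult h0
  exact onLeaf_rankZero_twoConverse_of_katoMainConjectureAtT h1 h2 h12 h31 hbody hread hMC W hcm (Or.inr hmult) h0

/-- **Item 19218 `GoodOrdinaryRankZeroTwoConverse` BY NAME, the good-ordinary twin** — the same four facts, two readings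
and the same object; `E[2]`-reducibility (every good-ordinary curve at `2` has a rational `2`-torsion point) plays no
role on this road. Nothing asserted; closes nothing by itself.
[cite: BurungaleTian2026, Thm. 3.1 and Remark 3.2] [cite: Kato2004Asterisque, Conj. 12.10 (p. 224) and §14.14 (p. 243)] -/
theorem goodOrdinaryRankZeroTwoConverse_of_katoMainConjectureAtT
    (h1 : nonempty_iwasawaH1Data) (h2 : nonempty_iwasawaH2Data) (h12 : thm12_4)
    (h31 : finite_descentCokernel_of_finite_selmer)
    (hbody : ∀ (W : WeierstrassCurve ℚ) [W.IsElliptic] [W.IsGloballyMinimal], ¬ W.HasCM →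
      letI : ContinuousSMul ℤ_[2] (W.tateModule 2) := TateModule.continuousSMul_padicInt
      haveI : Module.Free ℤ_[2] (W.tateModule 2) := W.module_free_tateModule_holds 2
      haveI : Module.Finite ℤ_[2] (W.tateModule 2) := W.module_finite_tateModule_holds 2
      ∃ (N : ℕ) (_ : NeZero N) (f : CuspForm (CongruenceSubgroup.Gamma0 N) 2) (_ : IsNewformOf W f)
        (ι : (m : ℕ) → (CyclotomicField m ℚ →+* ℂ)) (κ' : ℝ)
        (Λ' : ∀ (k : ℕ) (r : Finset (HeightOneSpectrum (𝓞 ℚ))),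
          H1 (tateRep W 2) (cycSubgroup 2 k r) →ₗ[ℤ_[2]] ℚ_[2] ⊗[ℚ] CyclotomicField (cycLevel 2 k r) ℚ)
        (c d a : ℤ) (A : ℕ)
        (z : ∀ (k : ℕ) (r : (cyclotomicLevelsRat 2 (badPlaces c d A N)).Ideals),
          H1 (tateRep W 2) ((cyclotomicLevelsRat 2 (badPlaces c d A N)).level k r.1))
        (x : ∀ (k : ℕ) (r : (cyclotomicLevelsRat 2 (badPlaces c d A N)).Ideals),
          CyclotomicField (cycLevel 2 k r.1) ℚ),
        ZetaBody W 2 f ι κ' Λ' c d a A z x)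
    (hread : ∀ (W : WeierstrassCurve ℚ) [W.IsElliptic] [W.IsGloballyMinimal], ¬ W.HasCM →
      letI : ContinuousSMul ℤ_[2] (W.tateModule 2) := TateModule.continuousSMul_padicInt
      haveI : Module.Free ℤ_[2] (W.tateModule 2) := W.module_free_tateModule_holds 2
      haveI : Module.Finite ℤ_[2] (W.tateModule 2) := W.module_finite_tateModule_holds 2
      ∀ (κ : ZpExtension ℚ 2) (γ : absoluteGaloisGroup ℚ) (hκ : κ.IsCyclotomic), κ.IsTopGenerator γ →
      ∀ (I : IwasawaH1Data W 2 κ γ) ⦃N : ℕ⦄ [NeZero N] (f : CuspForm (CongruenceSubgroup.Gamma0 N) 2),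
        IsNewformOf W f →
      ∀ (ι : (m : ℕ) → (CyclotomicField m ℚ →+* ℂ)) (κ' : ℝ)
        (Λ' : ∀ (k : ℕ) (r : Finset (HeightOneSpectrum (𝓞 ℚ))),
          H1 (tateRep W 2) (cycSubgroup 2 k r) →ₗ[ℤ_[2]] ℚ_[2] ⊗[ℚ] CyclotomicField (cycLevel 2 k r) ℚ)
        (c d a : ℤ) (A : ℕ)
        (z : ∀ (k : ℕ) (r : (cyclotomicLevelsRat 2 (badPlaces c d A N)).Ideals),
          H1 (tateRep W 2) ((cyclotomicLevelsRat 2 (badPlaces c d A N)).level k r.1))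
        (x : ∀ (k : ℕ) (r : (cyclotomicLevelsRat 2 (badPlaces c d A N)).Ideals),
          CyclotomicField (cycLevel 2 k r.1) ℚ),
        ZetaBody W 2 f ι κ' Λ' c d a A z x →
      ∀ y : I.H, (∀ n : ℕ, I.proj n y = levelToLayerTwo W hκ (badPlaces c d A N) n
          (z (n + 2) (cyclotomicLevelsRat 2 (badPlaces c d A N)).idealOne)) →
        y ≠ 0 ∧ (Finite (W.selmerGroupPInfty 2) → W.entireLFunction 1 = 0 → ∃ n : ℕ, 2 ^ n • I.proj 0 y = 0))
    (hMC : KatoMainConjectureAtTAtTwoOnLeaf) :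
    Summit.BirchSwinnertonDyer.BirchSwinnertonDyer.Theses.TwoAdicConverse.GoodOrdinaryRankZeroTwoConverse := by
  unfold Summit.BirchSwinnertonDyer.BirchSwinnertonDyer.Theses.TwoAdicConverse.GoodOrdinaryRankZeroTwoConverse
  intro W _ _ hcm hord h0
  exact onLeaf_rankZero_twoConverse_of_katoMainConjectureAtT h1 h2 h12 h31 hbody hread hMC W hcm (Or.inl hord) h0

end Summit.BirchSwinnertonDyer.BirchSwinnertonDyer.Theorems.TwoAdicKatoZetaGlue

end
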